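import Literature.NumberTheory.EllipticCurves.ManinConstantSemistablePrimewise
import Literature.NumberTheory.EllipticCurves.BSDRootNumberSmallConductorProofs
import Literature.NumberTheory.EllipticCurves.QuadraticTwist
import Literature.NumberTheory.EllipticCurves.Isogeny
import Literature.NumberTheory.EllipticCurves.HeegnerPoints
import HarnessLib

/-!
# Cai–Li–Zhai 2020 (J. London Math. Soc. 101), *On the 2-part of the Birch and Swinnerton-Dyer conjecture for quadratic twists of elliptic curves*: Thm. 1.1 and Thm. 1.5 AS PRINTED

HONEST FRAMING (cell `b2b-bsdres`, sub-lane `bsd-p2`, run/shared/lean/b2b/bsd-rank1-residual/p2/;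
literature typer 1, mandate (iv)): PUBLISHED theorems vendored as named `Prop`s (nothing asserted,
nothing discharged; D-0014), every printed hypothesis a binder, locators into the held text.
EVIDENCE of what print says at the prime `2` — here for ANALYTIC RANK ZERO quadratic twists of
optimal curves with `E(ℚ)[2] ≅ ℤ/2ℤ`; nothing booked; no mark moved.

Source. L. Cai, C. Li, S. Zhai, *On the 2-part of the Birch and Swinnerton-Dyer conjecture for
quadratic twists of elliptic curves*, J. Lond. Math. Soc. (2) **101** (2020), no. 2, 714–734,
doi:10.1112/jlms.12284 = arXiv:1712.01271 [CaiLiZhai2019] (bib key by the online year 2019). Text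
read: the held LaTeX-derived text `paper:arxiv-1712.01271` (16 chunks `p0001`–`p0016`, no PDF
pagination; locators are `chunk:line` plus the printed numbering, Thm. 1.1 = "Theorem (MainThm)",
Thm. 1.5 = Thm. 5.2 = "Theorem (MainThm-BSD)").

## The printed statements (verbatim)

* §1 conventions (p0003 L1–L23): BSD is displayed as (fbsd)
  `L^{(r_an)}(E,1)/(r_an! Ω(E) R(E)) = ∏_ℓ c_ℓ(E) · |Ш(E)| / |E(ℚ)_tor|²` ("`Ω(E)` the Tamagawa factor
  at infinity, `R(E)` the regulator"); "If `p` is any prime number, the equality of the powers of `p`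
  occurring on the two sides of (fbsd) is called the `p`-part of the exact Birch–Swinnerton-Dyer
  formula"; `L^{(alg)}(E,1) := L(E,1)/Ω_E` when `r_an = 0`, "where `Ω_E` is equal to `Ω_E⁺` or `2Ω_E⁺`,
  depending on whether `E(ℝ)` is connected, and here `Ω_E⁺` is the least positive real period of a
  Néron differential on a global minimal Weierstrass equation for `E`"; `E^{(m)}` = "the twist of `E`
  by this quadratic extension" for a quadratic discriminant `m`; `N_q = 1 + q − a_q` for good `q`;
  "We shall always assume that `E(ℚ)[2] ≅ ℤ/2ℤ`, and we write `E′ := E/E(ℚ)[2]` for the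
  `2`-isogenous curve of `E`"; `𝒮 = {q ≡ 1 mod 4 : q ∤ C, ord₂(N_q) = 1}`.
* §2 (p0005 L5–L16): `E` "the unique optimal elliptic curve in the `ℚ`-isogeny class",
  `φ : X₀(C) → E` not factoring through another curve of the class, `ν_E f(τ)dτ = φ^*(ω)` the Manin
  constant, "(mc2) `𝔏_E = ν_E Λ_f`" (`𝔏_E` the Néron lattice, `Λ_f` the period lattice of `f`),
  "`Ω_E^± = ν_E Ω_f^±`".
* **Theorem 1.1** (p0003 L25–L37): "Let `E` be an optimal elliptic curve over `ℚ` with conductor `C`.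
  Assume that (i) `E` has odd Manin constant; (ii) `E(ℚ)[2] ≅ ℤ/2ℤ`; (iii) `ord₂(L^{(alg)}(E,1)) = −1`.
  Let `M = q₁q₂⋯q_r` be a product of `r` distinct primes in `𝒮`. Then `L(E^{(M)},1) ≠ 0`, and we have
  `ord₂(L^{(alg)}(E^{(M)},1)) = r − 1`. In particular, `E^{(M)}(ℚ)` and `Ш(E^{(M)})` are both finite."
* Remark 1.4 (p0004 L1–L3): the Manin-constant hypothesis can be removed when `4 ∤ C` (Česnavičius);
  Remark 1.8 (p0004 L23–L25): "the theorem applies to elliptic curves with various different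
  reduction types at `2`": `X₀(14)` non-split multiplicative, `34A1` split multiplicative, `99C1` good
  ordinary, `X₀(36)`, `56B1` potentially supersingular — NO reduction hypothesis at `2`.
* **Theorem 1.5** (= Thm. 5.2; p0004 L6–L13 and p0012 L1–L9): "Let `E` and `M` be as in Theorem 1.1.
  Assume further that (1) `Ш(E′)[2] = 0`; (2) all primes `ℓ` which divide `2C` split in `ℚ(√M)`; (3) the
  `2`-part of the Birch and Swinnerton-Dyer conjecture holds for `E`. Then the `2`-primary component of
  `Ш(E^{(M)})` is zero, and the `2`-part of the Birch and Swinnerton-Dyer conjecture holds for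
  `E^{(M)}`." Proof (p0012 L11–L31): the `2`-part for `E` gives `Ш(E)[2] = 0`, `Sel₂(E) = ℤ/2`,
  `ord₂(∏ c_ℓ(E)) = 1`; Thm. 1.1 + Prop. 5.1 (Selmer comparison via Klagsbrun, p0011) give
  `E^{(M)}(ℚ)[2] = ℤ/2`, `ord₂(∏_{p ∣ CM} c_p(E^{(M)})) = r + 1`, `Ш(E^{(M)})[2] = 0`, whence
  `ord₂(∏ c_p · #Ш / |E^{(M)}(ℚ)_tor|²) = r − 1 = ord₂ L^{(alg)}(E^{(M)},1)`.

* **§6 worked families** (p0013–p0015). `A = X₀(14)` (= `14a1`), "minimal Weierstrass equation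
  `y² + xy + y = x³ + 4x − 6`, which has non-split multiplicative reduction at `2`. Moreover,
  `A(ℚ) = ℤ/6ℤ`. The discriminant of `A` is `−2⁶·7³` … `ℚ(A[2]) = ℚ(√−7)` … `L(A,1)/Ω_A⁺ = 1/6`"
  (p0013 L9–L17); Thm. 6.1 (p0013 L50–L99: `a_q mod 4` by `q mod 8` and the splitting of `q` in
  `ℚ(√−7)`); **Theorem 6.2** (p0013 L101–L110): "Let `M` be any integer of the form `M = q₁q₂⋯q_r`,
  `r ≥ 1`, with `q₁, …, q_r` arbitrary distinct odd primes all congruent to `5` modulo `8`, and inert in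
  `ℚ(√−7)`. We then have `ord₂(L^{(alg)}(A^{(M)},1)) = r − 1`. In particular, we have
  `L(A^{(M)},1) ≠ 0`."; Prop. 6.3 (p0013 L122–L125: `ord₂` of the Tamagawa factors of `A^{(M)}`);
  **Theorem 6.4** (p0014 L6–L9): same `M` ⇒ "the `2`-part of Birch and Swinnerton-Dyer conjecture is
  valid for `A^{(M)}`" (proof: Choi's `2`-descent gives `Ш(A^{(M)})[2] = 0`; `𝒮 = {5, 13, 61, 101, 157,
  173, 181, 229, 269, 293, 349, 397, …}`, p0014 L19–L21); **§6.2** (p0014 L23–L75), "the analogous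
  methods of quadratic twists of `X₀(14)` would apply, so we will not give the detailed proofs here":
  for `34A1: y² + xy = x³ − 3x + 1` (split multiplicative at `2`, `A(ℚ) = ℤ/6`, `L^{(alg)}(A,1) = 1/6`,
  `ℚ(A[2]) = ℚ(√17)`, `ℚ(A′[2]) = ℚ(√2)`; `q ≡ 1 (mod 4)` inert in `ℚ(√17)` and `ℚ(√2)`), `56B1:
  y² = x³ − x² − 4` (potentially supersingular at `2`, `A(ℚ) = ℤ/2`, `L^{(alg)} = 1/6`, `ℚ(A[2]) = ℚ(√−7)`,
  `ℚ(A′[2]) = ℚ(√2)`; `q ≡ 1 (4)` inert in both), `99C1: y² + xy = x³ − x² − 15x + 8` (good at `2`,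
  `a₂ = 1`, `A(ℚ) = ℤ/2`, `L^{(alg)} = 1/2`, `ℚ(A[2]) = ℚ(√33)`, `ℚ(A′[2]) = ℚ(√3)`; `q ≡ 1 (4)` inert in
  both): "Let `M = q₁q₂⋯q_r` be a product of `r` distinct primes in `𝒮`. We then have
  `ord₂(L^{(alg)}(A^{(M)},1)) = r − 1`, and the `2`-part of Birch and Swinnerton-Dyer conjecture is valid
  for all these twists."; **§6.3** (p0014 L77–p0015 L1): `46A1` twists (`q ≡ 1 (4)` inert in `ℚ(√−23)`,
  `ℚ(√2)`, `a_q ≠ 0`): `ord₂ L^{(alg)}(A^{(M)},1) = r − 1` by Thm. 1.1, the `2`-part by a `2`-descent or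
  by Thm. 1.5 for `r(M)` even and `M ≡ 1 (mod 8)`, and with [Wan] the full BSD — not typed (Wan's input).

## The `p = 2` flag of this file

These are `2`-ADIC theorems with NO parity exclusion and NO reduction-type restriction at `2`
(Rem. 1.8) — but they are ANALYTIC RANK ZERO statements only (`L(E^{(M)},1) ≠ 0` is a conclusion);
the rank-one analogue is NOT in this paper ("it would be possible to prove analogous results … for
rank one quadratic twists … by combining the Heegner points arguments [Coates2] and the explicit
Gross–Zagier formula [Cai2]", p0004 L26). Hypotheses that restrict the reach: `E` optimal with
odd Manin constant, `E(ℚ)[2] ≅ ℤ/2ℤ`, `ord₂ L^{(alg)}(E,1) = −1`, twisting primes `q ≡ 1 (mod 4)`,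
`q ∤ C`, `ord₂(N_q) = 1`; for the `2`-part additionally `Ш(E′)[2] = 0`, every `ℓ ∣ 2C` split in
`ℚ(√M)`, and the `2`-part of BSD for `E` itself (numerically verifiable per curve, Rem. 1.7).

## Transcription (tree dictionary)

* `E` optimal with Manin constant `ν_E`: a globally minimal model `W` with a modular-parametrisation
  datum `D : ModularParametrizationData W C` at level `C = W.conductorNorm ℤ` (the tree's conductor
  `N_E`) satisfying the LATTICE EQUALITY `Λ_E ⊆ c Λ_f` (with the structure field `c Λ_f ⊆ Λ_E`: `Λ_E = c Λ_f`,
  CLZ's (mc2) `𝔏_E = ν_E Λ_f`, which characterises the `X₀(C)`-optimal curve) — the rendering of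
  "optimal" already used by the tree's `mazur_not_dvd_maninConstant_of_odd` /
  `cesnavicius_not_two_dvd_maninConstant_of_two_dvd_level` (`ManinConstantSemistablePrimewise`);
  "odd Manin constant" = `¬ 2 ∣ D.maninConstant`.
* `L^{(alg)}(E,1) = L(E,1)/Ω_E` with `Ω_E = c_∞ Ω_E⁺ = ∫_{E(ℝ)}|ω|`: `W.entireLFunction 1 / W.realPeriodRat`
  for the globally minimal `W` (`realPeriodRat` = `∫_{E(ℝ)}|ω|`, components included,
  `BSDInvariants`); "`ord₂(…) = −1`" includes "is a rational number": `∃ q : ℚ, L(E,1) = q·Ω_E ∧ ord₂ q = −1`.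
* `E(ℚ)[2] ≅ ℤ/2ℤ`: `Nat.card {P ∈ E(ℚ) | 2P = O} = 2`.
* `N_q`: the tree's `reductionPointCount W q` (`= #Ẽ(𝔽_q)`, `GlobalMinimalModel`); `𝒮` = `InS W`.
* `M = q₁⋯q_r`: a nonempty finset `Q` of distinct primes in `𝒮`, `M = ∏ Q`, `r = #Q`.
* `E^{(M)}`: any globally minimal model `WM` `ℚ`-isomorphic to the tree's `W.quadraticTwist M`
  (`QuadraticTwist`; the pattern of `Pal2012.thm32_…`), so that `WM.realPeriodRat = Ω_{E^{(M)}}`.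
* `E′ = E/E(ℚ)[2]`: any `W′` with an isogeny `φ : W → W′` over `ℚ` (tree structure
  `WeierstrassCurve.Isogeny`) whose kernel has exactly `2` geometric points (then the kernel is the
  Galois-stable subgroup generated by the rational `2`-torsion point); "`Ш(E′)[2] = 0`": no element
  of order `2` in `W′.sha`.
* "all primes `ℓ ∣ 2C` split in `ℚ(√M)`": for every quadratic number field `K ∋ √M`, every prime
  `ℓ ∣ 2C` has exactly two primes of `𝓞_K` above it — the tree's `SatisfiesHeegnerHypothesis (2C) K`
  (`HeegnerPoints`: "every prime `p ∣ N` splits in `K`").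
* "the `p`-part of BSD holds for `E`" (p0003 L9–L11): `pPartBSD W p` below — the `p`-adic valuations
  of the two sides of (fbsd) agree, the left side being a rational number (`leadingLCoeff = L^{(r)}(E,1)/r!`,
  `realPeriodRat`, `regulator`, `tamagawaProduct`, `shaOrder`, `torsionOrder` of the tree).
* "the `2`-primary component of `Ш(E^{(M)})` is zero": `AddCommGroup.primaryComponent WM.sha 2 = ⊥`.
No `_holds` expected (modular symbols / Manin's formulas for twisted `L`-values, Klagsbrun's Selmer
comparison). Consumers take `(h : thm11_ord_two_LAlg_twist)` etc.

## References
* [CaiLiZhai2019] J. Lond. Math. Soc. 101 (2020) 714–734 = arXiv:1712.01271: §1 (Thm. 1.1, Rem.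
  1.2–1.4, Thm. 1.5, Rem. 1.6–1.8), §2 (Manin constant, (mc2)), §4 (Thm. 4.2, 4.3), §5 (Prop. 5.1,
  Thm. 5.2), §6 (twists of `X₀(14)`, `34A1`, `56B1`, `99C1`).
* [Cesnavicius2018] K. Česnavičius, *The Manin constant in the semistable case* (Rem. 1.4).
-/

noncomputable section

open scoped Classical MatrixGroups ModularForm

open CongruenceSubgroup WeierstrassCurve Literature.NumberTheory.EllipticCurves
  Literature.NumberTheory.EllipticCurves.ModularForms

namespace Literature.NumberTheory.EllipticCurves.CaiLiZhai2019

/-! ### §1. Vocabulary (definitions with bodies; nothing asserted) -/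

/-- The set `𝒮 = {q ≡ 1 (mod 4) prime : q ∤ C, ord₂(N_q) = 1}` of twisting primes of Cai–Li–Zhai,
for a globally minimal model `W` of `E` (`C = N_E = W.conductorNorm ℤ`, `N_q = #Ẽ(𝔽_q) =
reductionPointCount W q`). [cite: CaiLiZhai2019, §1 (arXiv:1712.01271 chunk p0003 L21–L23)] -/
def InS (W : WeierstrassCurve ℚ) [W.IsGloballyMinimal] (q : ℕ) : Prop :=
  q.Prime ∧ q % 4 = 1 ∧ ¬ q ∣ W.conductorNorm ℤ ∧ padicValNat 2 (W.reductionPointCount q) = 1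

/-- "`E` is optimal with ODD Manin constant", in the tree's lattice rendering: a modular
parametrisation datum `D` of the globally minimal `W` at level `N_E` whose Néron lattice satisfies
`Λ_E ⊆ c Λ_f` (so `Λ_E = c Λ_f`, CLZ's (mc2) `𝔏_E = ν_E Λ_f`, characterising the `X₀(N_E)`-optimal curve,
`c = ν_E` its Manin constant) and `2 ∤ c`. [cite: CaiLiZhai2019, §2 (chunk p0005 L5–L16) and Thm. 1.1 hypothesis (1)] -/
def IsOptimalDatumWithOddManinConstant (W : WeierstrassCurve ℚ) {N : ℕ} [NeZero N]
    (D : ModularParametrizationData W N) : Prop :=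
  (∀ z ∈ D.L.lattice, ∃ w ∈ periodLattice D.f, z = D.c * w) ∧ ¬ (2 : ℤ) ∣ D.maninConstant

/-- "The `p`-part of the exact Birch–Swinnerton-Dyer formula holds for `E`" (CLZ §1: "the equality of
the powers of `p` occurring on the two sides of (fbsd)
`L^{(r_an)}(E,1)/(r_an! Ω(E) R(E)) = ∏_ℓ c_ℓ(E)·|Ш(E)|/|E(ℚ)_tor|²`"), for a globally minimal model `V`:
the left side is a rational number `q` (`leadingLCoeff = L^{(r)}(E,1)/r!`, `realPeriodRat = Ω(E)`,
`regulator = R(E)`) and `ord_p q = ord_p(∏ c_ℓ · #Ш / #E(ℚ)_tor²)` (`shaOrder` is meaningful for finite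
`Ш`, the case of the paper). A predicate; nothing asserted.
[cite: CaiLiZhai2019, §1, (fbsd) and the sentence following it (chunk p0003 L3–L11)] -/
def pPartBSD (V : WeierstrassCurve ℚ) (p : ℕ) : Prop :=
  ∃ q : ℚ, V.leadingLCoeff = (q : ℂ) * (V.realPeriodRat : ℂ) * (V.regulator : ℂ) ∧
    padicValRat p q =
      padicValRat p ((V.tamagawaProduct : ℚ) * V.shaOrder / (V.torsionOrder : ℚ) ^ 2)

/-! ### §2. The printed theorems (named facts; nothing asserted) -/

/-- **Cai–Li–Zhai 2020, Theorem 1.1** (verbatim in the module docstring). `E/ℚ` optimal of conductor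
`C` with odd Manin constant (globally minimal `W`, datum `D` at level `C = N_E` with
`IsOptimalDatumWithOddManinConstant`), `E(ℚ)[2] ≅ ℤ/2ℤ`, `ord₂(L(E,1)/Ω_E) = −1`; `M = ∏ Q` for a
nonempty finite set `Q` of distinct primes in `𝒮` (`InS W`), `r = #Q`; `WM` a globally minimal model
of the twist `E^{(M)}`. Then `L(E^{(M)},1) ≠ 0`, `ord₂(L(E^{(M)},1)/Ω_{E^{(M)}}) = r − 1`, and
`E^{(M)}(ℚ)`, `Ш(E^{(M)})` are finite. ANALYTIC RANK ZERO at `p = 2`; no reduction hypothesis at `2`.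
No `_holds` expected. [cite: CaiLiZhai2019, Thm. 1.1 (arXiv:1712.01271 §1, chunk p0003 L25–L37); Thm. 4.2 / 4.3 (chunks p0009 L97–p0010 L78)] -/
def thm11_ord_two_LAlg_twist : Prop :=
  ∀ (W : WeierstrassCurve ℚ) [W.IsElliptic] [W.IsGloballyMinimal] [NeZero (W.conductorNorm ℤ)]
    (D : ModularParametrizationData W (W.conductorNorm ℤ)),
    IsOptimalDatumWithOddManinConstant W D →
    Nat.card {P : W.toAffine.Point // (2 : ℕ) • P = 0} = 2 →
    (∃ q : ℚ, W.entireLFunction 1 = (q : ℂ) * (W.realPeriodRat : ℂ) ∧ padicValRat 2 q = -1) →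
    ∀ (Q : Finset ℕ), Q.Nonempty → (∀ q ∈ Q, InS W q) →
    ∀ (WM : WeierstrassCurve ℚ) [WM.IsElliptic] [WM.IsGloballyMinimal],
      (∃ C : VariableChange ℚ, C • W.quadraticTwist ((∏ q ∈ Q, q : ℕ) : ℚ) = WM) →
        WM.entireLFunction 1 ≠ 0 ∧
        (∃ q : ℚ, WM.entireLFunction 1 = (q : ℂ) * (WM.realPeriodRat : ℂ) ∧
          padicValRat 2 q = (Q.card : ℤ) - 1) ∧
        Finite WM.toAffine.Point ∧ Finite WM.sha

/-- **Cai–Li–Zhai 2020, Theorem 1.5 (= Thm. 5.2)** (verbatim in the module docstring). With `E`, `Q`,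
`M = ∏ Q`, `WM` as in Thm. 1.1 and additionally: `E′ = E/E(ℚ)[2]` (any `W′` receiving an isogeny from
`W` over `ℚ` with kernel of order `2`) has `Ш(E′)[2] = 0`; every prime `ℓ ∣ 2C` splits in `ℚ(√M)`
(`SatisfiesHeegnerHypothesis (2C) K` for every quadratic field `K ∋ √M`); and the `2`-part of BSD holds
for `E` (`pPartBSD W 2`). Then `Ш(E^{(M)})(2) = 0` and the `2`-part of BSD holds for `E^{(M)}`
(`pPartBSD WM 2`). ANALYTIC RANK ZERO at `p = 2`. No `_holds` expected.
[cite: CaiLiZhai2019, Thm. 1.5 (arXiv:1712.01271 §1, chunk p0004 L6–L13) = Thm. 5.2 (chunk p0012 L1–L31); Prop. 5.1 (chunk p0011)] -/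
def thm15_twoPartBSD_twist : Prop :=
  ∀ (W : WeierstrassCurve ℚ) [W.IsElliptic] [W.IsGloballyMinimal] [NeZero (W.conductorNorm ℤ)]
    (D : ModularParametrizationData W (W.conductorNorm ℤ)),
    IsOptimalDatumWithOddManinConstant W D →
    Nat.card {P : W.toAffine.Point // (2 : ℕ) • P = 0} = 2 →
    (∃ q : ℚ, W.entireLFunction 1 = (q : ℂ) * (W.realPeriodRat : ℂ) ∧ padicValRat 2 q = -1) →
    ∀ (Q : Finset ℕ), Q.Nonempty → (∀ q ∈ Q, InS W q) →
    ∀ (WM : WeierstrassCurve ℚ) [WM.IsElliptic] [WM.IsGloballyMinimal],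
      (∃ C : VariableChange ℚ, C • W.quadraticTwist ((∏ q ∈ Q, q : ℕ) : ℚ) = WM) →
    -- (1) `Ш(E′)[2] = 0` for the `2`-isogenous curve `E′ = E / E(ℚ)[2]`
    ∀ (W' : WeierstrassCurve ℚ) (φ : Isogeny W W'),
      Nat.card φ.toAddMonoidHom.ker = 2 → (∀ x ∈ W'.sha, (2 : ℕ) • x = 0 → x = 0) →
    -- (2) all primes `ℓ ∣ 2C` split in `ℚ(√M)`
    (∀ (K : Type) [Field K] [NumberField K], Module.finrank ℚ K = 2 →
      (∃ x : K, x ^ 2 = ((∏ q ∈ Q, q : ℕ) : K)) →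
        SatisfiesHeegnerHypothesis (2 * W.conductorNorm ℤ) K) →
    -- (3) the `2`-part of BSD for `E`
    pPartBSD W 2 →
      AddCommGroup.primaryComponent WM.sha 2 = ⊥ ∧ pPartBSD WM 2

/-! ### §3. Bookkeeping (proved): the `2`-part in Miller's currency -/

/-- `pPartBSD V p` unfolded (by definition). [cite: CaiLiZhai2019, §1 (fbsd)] -/
theorem pPartBSD_iff (V : WeierstrassCurve ℚ) (p : ℕ) :
    pPartBSD V p ↔ ∃ q : ℚ, V.leadingLCoeff = (q : ℂ) * (V.realPeriodRat : ℂ) * (V.regulator : ℂ) ∧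
      padicValRat p q =
        padicValRat p ((V.tamagawaProduct : ℚ) * V.shaOrder / (V.torsionOrder : ℚ) ^ 2) :=
  Iff.rfl


/-! ### §4. The worked families of §6 (named facts; nothing asserted)

Explicit infinite families of ANALYTIC RANK ZERO quadratic twists for which the paper states the
`2`-part of BSD: twists of `X₀(14)` (Thms. 6.2, 6.4, with proofs) and of `34A1`, `56B1`, `99C1`
(§6.2, stated, "we will not give the detailed proofs here"). Typed on the printed minimal equations;
the twist `A^{(M)}` is any global minimal model of the tree's `quadraticTwist` (as in §2). "Inert in
`ℚ(√d)`" = the principal ideal `(q)` of `𝓞_K` is prime, for every quadratic number field `K ∋ √d`. -/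

/-- "`q` is inert in `ℚ(√d)`": in every quadratic number field `K` containing a square root of `d`
(all copies of `ℚ(√d)` for `d` not a rational square) the ideal `q𝓞_K` is prime.
[cite: CaiLiZhai2019, Thm. 6.2 ("inert in ℚ(√−7)") (chunk p0013 L101–L104)] -/
def IsInertIn (q : ℕ) (d : ℤ) : Prop :=
  ∀ (K : Type) [Field K] [NumberField K], Module.finrank ℚ K = 2 → (∃ x : K, x ^ 2 = (d : K)) →
    (Ideal.span {((q : ℤ) : NumberField.RingOfIntegers K)}).IsPrime

/-- `A = X₀(14)` (Cremona `14a1`): "a minimal Weierstrass equation given by `y² + xy + y = x³ + 4x − 6`"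
(`a₁ = 1, a₂ = 0, a₃ = 1, a₄ = 4, a₆ = −6`). [cite: CaiLiZhai2019, §6.1 (chunk p0013 L9–L13)] -/
def X014 : WeierstrassCurve ℚ := ⟨1, 0, 1, 4, -6⟩

/-- `34A1`: "minimal Weierstrass equation `y² + xy = x³ − 3x + 1`". [cite: CaiLiZhai2019, §6.2.1 (chunk p0014 L27–L31)] -/
def C34A1 : WeierstrassCurve ℚ := ⟨1, 0, 0, -3, 1⟩

/-- `56B1`: "minimal Weierstrass equation `y² = x³ − x² − 4`". [cite: CaiLiZhai2019, §6.2.2 (chunk p0014 L45–L49)] -/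
def C56B1 : WeierstrassCurve ℚ := ⟨0, -1, 0, 0, -4⟩

/-- `99C1`: "minimal Weierstrass equation `y² + xy = x³ − x² − 15x + 8`". [cite: CaiLiZhai2019, §6.2.3 (chunk p0014 L61–L65)] -/
def C99C1 : WeierstrassCurve ℚ := ⟨1, -1, 0, -15, 8⟩

/-- The common conclusion shape of §6 for a base curve `A` and a twisting set `Q` (`M = ∏ Q`,
`r = #Q`): for every global minimal model `WM` of `A^{(M)}`, `L(A^{(M)},1) ≠ 0`,
`ord₂(L(A^{(M)},1)/Ω_{A^{(M)}}) = r − 1`, and the `2`-part of BSD holds for `A^{(M)}` (`pPartBSD WM 2`).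
A predicate; nothing asserted. [cite: CaiLiZhai2019, Thm. 6.2, Thm. 6.4, §6.2 (chunks p0013 L101–p0014 L75)] -/
def TwistConclusionAtTwo (A : WeierstrassCurve ℚ) (Q : Finset ℕ) : Prop :=
  ∀ (WM : WeierstrassCurve ℚ) [WM.IsElliptic] [WM.IsGloballyMinimal],
    (∃ C : VariableChange ℚ, C • A.quadraticTwist ((∏ q ∈ Q, q : ℕ) : ℚ) = WM) →
      WM.entireLFunction 1 ≠ 0 ∧
      (∃ x : ℚ, WM.entireLFunction 1 = (x : ℂ) * (WM.realPeriodRat : ℂ) ∧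
        padicValRat 2 x = (Q.card : ℤ) - 1) ∧
      pPartBSD WM 2

/-- **Cai–Li–Zhai 2020, Theorems 6.2 and 6.4 (quadratic twists of `X₀(14)`)** — verbatim in the
module docstring: for `M = q₁⋯q_r`, `r ≥ 1`, distinct odd primes all `≡ 5 (mod 8)` and inert in
`ℚ(√−7)`: `ord₂(L^{(alg)}(A^{(M)},1)) = r − 1`, `L(A^{(M)},1) ≠ 0` (Thm. 6.2), and the `2`-part of BSD
holds for `A^{(M)}` (Thm. 6.4; `Ш(A^{(M)})[2] = 0` by Choi's `2`-descent). `A = X014`, non-split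
multiplicative at `2`. ANALYTIC RANK ZERO, AT 2. No `_holds` expected.
[cite: CaiLiZhai2019, Thm. 6.2 (chunk p0013 L101–L110) and Thm. 6.4 (chunk p0014 L6–L17)] -/
def thm62_thm64_twists_X014 : Prop :=
  ∀ (Q : Finset ℕ), Q.Nonempty →
    (∀ q ∈ Q, q.Prime ∧ q % 8 = 5 ∧ IsInertIn q (-7)) →
      TwistConclusionAtTwo X014 Q

/-- **Cai–Li–Zhai 2020, §6.2 (quadratic twists of `34A1`, `56B1`, `99C1`)** — verbatim in the module
docstring; printed as results WITHOUT detailed proofs ("the analogous methods of quadratic twists of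
`X₀(14)` would apply, so we will not give the detailed proofs here"): for `M` a product of `r ≥ 1`
distinct primes `q ≡ 1 (mod 4)` inert in `ℚ(√17)` and `ℚ(√2)` (`34A1`, split multiplicative at `2`),
resp. inert in `ℚ(√−7)` and `ℚ(√2)` (`56B1`, potentially supersingular at `2`), resp. inert in `ℚ(√33)`
and `ℚ(√3)` (`99C1`, good ordinary at `2`): `ord₂(L^{(alg)}(A^{(M)},1)) = r − 1` and the `2`-part of BSD
holds for `A^{(M)}`. ANALYTIC RANK ZERO, AT 2; flagged "proof not printed in detail". No `_holds` expected.
[cite: CaiLiZhai2019, §6.2.1–6.2.3 (chunk p0014 L23–L75)] -/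
def sec62_twists_34A1_56B1_99C1 : Prop :=
  (∀ (Q : Finset ℕ), Q.Nonempty →
    (∀ q ∈ Q, q.Prime ∧ q % 4 = 1 ∧ IsInertIn q 17 ∧ IsInertIn q 2) →
      TwistConclusionAtTwo C34A1 Q) ∧
  (∀ (Q : Finset ℕ), Q.Nonempty →
    (∀ q ∈ Q, q.Prime ∧ q % 4 = 1 ∧ IsInertIn q (-7) ∧ IsInertIn q 2) →
      TwistConclusionAtTwo C56B1 Q) ∧
  (∀ (Q : Finset ℕ), Q.Nonempty →
    (∀ q ∈ Q, q.Prime ∧ q % 4 = 1 ∧ IsInertIn q 33 ∧ IsInertIn q 3) →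
      TwistConclusionAtTwo C99C1 Q)

/-- Bookkeeping (proved): Thm. 6.2/6.4 applied to a single prime `q ≡ 5 (mod 8)` inert in `ℚ(√−7)`
(`r = 1`: `ord₂ L^{(alg)}(A^{(q)},1) = 0` and the `2`-part of BSD for `A^{(q)}`), e.g. the printed
`q ∈ {5, 13, 61, 101, …}` once inertness is supplied. [cite: CaiLiZhai2019, Thm. 6.4 and the list 𝒮 (chunk p0014 L6–L21)] -/
theorem twistConclusionAtTwo_X014_singleton (h : thm62_thm64_twists_X014) {q : ℕ} (hq : q.Prime)
    (h8 : q % 8 = 5) (hin : IsInertIn q (-7)) : TwistConclusionAtTwo X014 {q} :=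
  h {q} (Finset.singleton_nonempty q) (by
    intro q' hq'
    rw [Finset.mem_singleton] at hq'
    subst hq'
    exact ⟨hq, h8, hin⟩)

end Literature.NumberTheory.EllipticCurves.CaiLiZhai2019

end
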